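import Literature.AlgebraicGeometry.ShimuraVarieties.UnitaryShimuraCurveRecord
import Literature.AlgebraicGeometry.ShimuraVarieties.SpecialCycleClasses
import HarnessLib

/-!
# No unitary Shimura CURVE record system exists at a frame whose Gram matrix has EMPTY negative cone
# (`RecordSystemGS L J⋆ τ K₀` is empty when `J⋆^τ` is positive semidefinite)

Topic `AlgebraicGeometry/ShimuraVarieties`, namespaces `…ShimuraVarieties` (two generic cone lemmas) and
`…ShimuraVarieties.UnitaryCanonicalModel`.  THEOREMS ONLY (no definition, no named fact, no instance, no `sorry`); imports ★ GS-2
`UnitaryShimuraCurveRecord` + ★ `SpecialCycleClasses` (for ★ `UnitaryBallUniformisationDatum.cone_nonempty`) + HarnessLib.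
Cell `hodgecm-mathlib`, GS-6 (β) glue, generic half of the «junk branch» (placement row L-10; author A-p18 g8, bytes of record
`G4vac-recordSystemGS-definite` — declarations byte-identical; filed by the wave-1 courier A-p14 g9); books 0.

QUESTION ANSWERED: is `RecordSystemGS F Jstar ι₁ K₀` inhabitable at a frame where `Jstar.map ι₁` is (semi)definite?  **NO — it is EMPTY,
by the field `pieces`**: at the level `K₀` itself the pieces presentation supplies, for the class `q₁ = ⟦1⟧` of the (always inhabited)
index set `U(J⋆)(L⁺)∖U(J⋆)(𝔸_{L⁺,f})/K₀`, a `UnitaryBallUniformisationDatum 1 (X q₁)` whose complex Gram matrix IS `J⋆^τ`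
(`(B q₁).Hℂ = Jstar.map τ`), and such a datum carries a Sylvester frame of signature `(1,1)` (field `signature_τ₁`), whose last vector
is NEGATIVE (★ `cone_nonempty`); so `negCone (J⋆^τ) ≠ ∅`.  Hence: `RecordSystemGS.negCone_nonempty`,
`RecordSystemGS.isEmpty_of_negCone_eq_empty`, and for a positive SEMIDEFINITE `J⋆^τ` (Mathlib `Matrix.PosSemidef`, `ComplexOrder`)
`negCone_eq_empty_of_posSemidef` / `RecordSystemGS.isEmpty_of_posSemidef` / `RecordSystemGS.false_of_posSemidef`.  The fields
`pts`/`hol`/`recip` do NOT force inhabitation (they are vacuous over the empty Shimura set); `pieces` does, through the BALL datum's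
signature field.  (The step «`(ι₁ (J⊥ 0 0)).re < 0` ⇒ `J⋆^{ι₁}` positive definite» of the GS-6 discharge is Sylvester bookkeeping on the
frame `ᵗ(cB)·(a′H)·B = J⋆ ⊕ J⊥` with `a′ > 0`, `H` of signature `(2,1)` — Summits side, not here.)  HC_CM is proved only modulo the 7
printed citations until rung 0 closes.

References: [BergeronMillsonMoeglin2016Balls] Part 2 §§1.1, 1.3 (signature `(p,1)`; `X` = negative lines); [Milne2005ShimuraVarieties] §13
p. 118 (canonical models); [Liu2021] proof of Thm. 4.15, l. 2193–2208 (`V⋆^⊥` totally positive definite — the print never meets this branch).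
-/

set_option autoImplicit false

noncomputable section

open Function MulAction NumberField Matrix
open scoped Matrix ComplexOrder
open Literature.AlgebraicGeometry.Motives
open Literature.NumberTheory.Automorphic Literature.NumberTheory.Automorphic.UnitaryGroup
open Literature.NumberTheory.Automorphic.ShimuraDissection
open Literature.NumberTheory.Automorphic.Liu2021.AppendixC (C5.OpenCompactSubgroup C5.SmallLevel)

namespace Literature.AlgebraicGeometry.ShimuraVarieties

/-- A complex Gram matrix with `0 ≤ Re ⟪v, v⟫` for every `v` has EMPTY negative cone. [cite: BergeronMillsonMoeglin2016Balls, Part 2 §1.3] -/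
theorem negCone_eq_empty_of_forall_re_nonneg {m : Type} [Fintype m] {Hc : Matrix m m ℂ}
    (h : ∀ v : m → ℂ, 0 ≤ (star v ⬝ᵥ (Hc *ᵥ v)).re) : negCone Hc = ∅ :=
  Set.eq_empty_iff_forall_notMem.2 fun v hv => (not_lt.2 (h v)) (mem_negCone_iff.1 hv)

/-- A positive SEMIDEFINITE complex Gram matrix (Mathlib `Matrix.PosSemidef`, `ComplexOrder`) has empty negative cone.
[cite: BergeronMillsonMoeglin2016Balls, Part 2 §1.3] -/
theorem negCone_eq_empty_of_posSemidef {m : Type} [Fintype m] {Hc : Matrix m m ℂ} (h : Hc.PosSemidef) : negCone Hc = ∅ :=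
  negCone_eq_empty_of_forall_re_nonneg fun v => (Complex.nonneg_iff.1 (h.dotProduct_mulVec_nonneg v)).1

namespace UnitaryCanonicalModel

variable {L : Type} [Field L] [NumberField L] [IsCMField L] {Jstar : Matrix (Fin 2) (Fin 2) L} {τ : L →+* ℂ}
  {K₀ : C5.OpenCompactSubgroup ↥(finAdelic (↥(maximalRealSubfield L)) L (IsCMField.complexConj L) 2 Jstar)}

/-- **A curve record system forces the negative cone of `J⋆^τ` to be NONEMPTY** (field `pieces` at the level `K₀`, class `⟦1⟧`: the ball datum
of that piece has complex Gram matrix `J⋆^τ` and a Sylvester frame of signature `(1,1)`, whose last vector is negative — ★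
`UnitaryBallUniformisationDatum.cone_nonempty`). [cite: BergeronMillsonMoeglin2016Balls, Part 2 §§1.1, 1.3] [cite: Milne2005ShimuraVarieties, §13 p. 118] -/
theorem RecordSystemGS.negCone_nonempty (S : RecordSystemGS L Jstar τ K₀) : (negCone (Jstar.map τ)).Nonempty := by
  letI : Algebra L ℂ := τ.toAlgebra
  obtain ⟨g, -, X, ι, -, B, hB⟩ := S.pieces ⟨K₀, le_rfl⟩
  have h := (B (Quotient.mk'' (CosetSpace.pt (rationalToFinAdelic (↥(maximalRealSubfield L)) L (IsCMField.complexConj L) 2 Jstar)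
    (⟨K₀, le_rfl⟩ : C5.SmallLevel K₀).1.1 1))).cone_nonempty
  rwa [UnitaryBallUniformisationDatum.cone, (hB _).1] at h

/-- **No curve record system exists when the negative cone of `J⋆^τ` is empty.** [cite: BergeronMillsonMoeglin2016Balls, Part 2 §1.3]
[cite: Milne2005ShimuraVarieties, §13 p. 118] -/
theorem RecordSystemGS.isEmpty_of_negCone_eq_empty (h : negCone (Jstar.map τ) = ∅) : IsEmpty (RecordSystemGS L Jstar τ K₀) :=
  ⟨fun S => by simpa [h] using S.negCone_nonempty⟩

/-- **No curve record system exists at a frame where `J⋆^τ` is positive semidefinite** (in particular positive definite — the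
`(ι₁ (J⊥ 0 0)).re < 0` branch of ★ GS-6 `frobeniusActsByGS` after Sylvester bookkeeping on the frame): every `∀ S : RecordSystemGS …`
statement there is vacuous. [cite: BergeronMillsonMoeglin2016Balls, Part 2 §§1.1, 1.3] [cite: Milne2005ShimuraVarieties, §13 p. 118] -/
theorem RecordSystemGS.isEmpty_of_posSemidef (h : (Jstar.map τ).PosSemidef) : IsEmpty (RecordSystemGS L Jstar τ K₀) :=
  RecordSystemGS.isEmpty_of_negCone_eq_empty (negCone_eq_empty_of_posSemidef h)

/-- Pointwise form for consumers holding a record as a binder: `S : RecordSystemGS …` and `J⋆^τ` positive semidefinite ⇒ anything.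
[cite: BergeronMillsonMoeglin2016Balls, Part 2 §1.3] -/
theorem RecordSystemGS.false_of_posSemidef (S : RecordSystemGS L Jstar τ K₀) (h : (Jstar.map τ).PosSemidef) : False :=
  (RecordSystemGS.isEmpty_of_posSemidef h).false S

end UnitaryCanonicalModel

end Literature.AlgebraicGeometry.ShimuraVarieties

end
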